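import Mathlib
import Summits.NavierStokesRegularity.NavierStokesRegularity.Theses.AdaptedFrequency
import Literature.Analysis.FluidPDE.AdaptedBackwardKernel
import Literature.Analysis.FluidPDE.SelfSimilar
import Literature.Analysis.FluidPDE.TsaiHeadPressureIdentity

/-!
# Crux-ideate sketch — FrequencyRigidity (stmt-NavierStokesRegularity-2955), ideator 3, round 1

First-lemma signatures for the three idea cards
`kernel-paired-head-pressure`, `radial-vorticity-antidynamo`, `vorticity-cokernel-duality`.
Every `def … : Prop` below elaborates; nothing is proved here (the `_of` theorems at the end are
trivial sanity links only). Physical variables throughout: `v` the velocity on `(−∞,0) × ℝ³`,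
`K` the adapted kernel at `(0,0)`, `H = adaptedEnstrophy v K`, `Λ = adaptedFrequency v K 0`.
-/

noncomputable section

namespace Summit.NavierStokesRegularity.NavierStokesRegularity.Cruxes.FrequencyRigidity.Ideator3

open MeasureTheory Set Filter Topology Function
open scoped Laplacian InnerProductSpace RealInnerProductSpace
open Literature.Analysis.FluidPDE

local notation "ℝ³" => EuclideanSpace ℝ (Fin 3)

/-! ## Card `kernel-paired-head-pressure` -/

/-- **(1a) Scaling pincer.** For any object in the `∃`-body of `FrequencyRigidity` whose vorticity
obeys the Type-I smoothing bound `|curl v| ≤ C'/(−t)` and whose adapted enstrophy is differentiable,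
constancy of the adapted frequency forces `Λ₀ = 2` and the EXACT power law `H(t) = A/t²`
(`A > 0`): `Λ ≡ Λ₀` integrates to `H = A(−t)^{−Λ₀}`, while `H ≤ C'²/t²` on all of `(−∞,0)`
(unit mass of `K`) kills `Λ₀ < 2` at `t → −∞` and `Λ₀ > 2` at `t → 0⁻`. -/
def FrequencyPincer : Prop :=
  ∀ (ν C' Λ₀ : ℝ) (v : ℝ → ℝ³ → ℝ³) (K : ℝ → ℝ³ → ℝ),
    IsAdaptedBackwardKernel ν v (Iio 0) 0 0 K →
    (∀ t < (0:ℝ), ∀ x, ‖curl (v t) x‖ ≤ C' / (-t)) →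
    (∀ t < (0:ℝ), Integrable (fun x => ‖curl (v t) x‖ ^ 2 * K t x)) →
    (∀ t < (0:ℝ), DifferentiableAt ℝ (adaptedEnstrophy v K) t) →
    (∀ t < (0:ℝ), 0 < adaptedEnstrophy v K t) →
    (∀ t < (0:ℝ), adaptedFrequency v K 0 t = Λ₀) →
    Λ₀ = 2 ∧ ∃ A : ℝ, 0 < A ∧ ∀ t < (0:ℝ), adaptedEnstrophy v K t = A / t ^ 2

/-- **(1b) Tsai's bounded-profile Liouville theorem by kernel pairing** (replaces the maximum
principle of Tsai 1998, Thm 1, `q = ∞`, print-only in the tree). Pair Tsai's identity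
`driftOp ν a U Π = ν|curl U|²` (`IsLerayProfile.driftOp_headPressure_eq_half_sum_sq`) with a
STEADY ADAPTED KERNEL `ρ` — a positive, Gaussian-decaying solution of the adjoint equation
`νΔρ + div(ρ (U + a y)) = 0` (the invariant density of the diffusion with drift `−(U + a y)`):
`∫ (driftOp Π) ρ = ∫ Π (νΔρ + div(ρ(U + a y))) = 0`, hence `∫ |curl U|² ρ = 0`, `curl U ≡ 0`
(so `U` is a bounded harmonic field, i.e. a constant — the Galilei-wobble profiles, which the crux
excludes by `H > 0`). -/
def TsaiBoundedViaSteadyKernel : Prop :=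
  ∀ (ν a : ℝ) (U : ℝ³ → ℝ³) (P : ℝ³ → ℝ) (ρ : ℝ³ → ℝ),
    0 < ν → 0 < a → IsLerayProfile ν a U P → ContDiff ℝ ⊤ U →
    (∃ M : ℝ, ∀ y, ‖U y‖ + ‖fderiv ℝ U y‖ + ‖iteratedFDeriv ℝ 2 U y‖ ≤ M) →
    (∃ (M : ℝ) (k : ℕ), ∀ y, |P y| + ‖fderiv ℝ P y‖ ≤ M * (1 + ‖y‖) ^ k) →
    ContDiff ℝ 2 ρ → (∀ y, 0 < ρ y) →
    (∀ y, ν * (Δ ρ) y + VectorCalculus.divergence (fun z => ρ z • (U z + a • z)) y = 0) →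
    (∃ c κ : ℝ, 0 < κ ∧ ∀ y, |ρ y| + ‖fderiv ℝ ρ y‖ ≤ c * Real.exp (-κ * ‖y‖ ^ 2)) →
    ∀ y, curl U y = 0

/-- **(1c) The eternal kernel-paired head-pressure budget** (physical variables). For a classical
NS flow `v` with pressure `q` on `(−∞,0)` and an adapted kernel `K` at `(0,0)`, the total head
`π = |v|²/2 + q` satisfies `(∂ₜ + v·∇ − νΔ)π = ∂ₜq − ν|curl v|²`, so pairing with `K` (transport and
drift drop out EXACTLY by adjointness): `d/dt ∫ π K = −ν H(t) + ∫ (∂ₜ q) K`, i.e.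
`d/dt ∫ (|v|²/2) K = −ν H(t) − ∫ q ∂ₜK`.  The adapted enstrophy is paid for, exactly, by the
correlation of the pressure with the kernel's unsteadiness. -/
def KernelHeadBudget : Prop :=
  ∀ (ν : ℝ) (v : ℝ → ℝ³ → ℝ³) (q : ℝ → ℝ³ → ℝ) (K : ℝ → ℝ³ → ℝ),
    0 < ν → IsClassicalNSSolutionOn (Iio 0) ν 0 v q →
    IsAdaptedBackwardKernel ν v (Iio 0) 0 0 K → IsGaussianComparable K (Iio 0) 0 0 →
    (∃ (M : ℝ) (k : ℕ), ∀ t < (0:ℝ), ∀ x, ‖v t x‖ + ‖fderiv ℝ (v t) x‖ + |q t x| +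
        ‖timeDerivWithin (Iio 0) v t x‖ + |timeDerivWithin (Iio 0) q t x| ≤ M * (1 + ‖x‖) ^ k / (-t) ^ k) →
    ∀ t < (0:ℝ),
      HasDerivAt (fun s => ∫ x, (2⁻¹ * ‖v s x‖ ^ 2) * K s x)
        (-(ν * adaptedEnstrophy v K t) - ∫ x, q t x * timeDerivWithin (Iio 0) K t x) t

/-! ## Card `radial-vorticity-antidynamo` -/

/-- The radial vorticity `m(t,x) = ⟪x, curl v(t) x⟫` (the "radial magnetic field" of the dynamo
dictionary). -/
def radialVorticity (v : ℝ → ℝ³ → ℝ³) (t : ℝ) (x : ℝ³) : ℝ := ⟪x, curl (v t) x⟫_ℝ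

/-- **(2a) The radial-vorticity law.** For a classical NS flow, `m = x·ω` is advected and diffused
with the single source `ω·∇(x·v)` (stretching of the radial VELOCITY):
`(∂ₜ + v·∇ − νΔ)(x·ω) = ω·∇(x·v)`. (From the vorticity equation: `x·((v·∇)ω) = v·∇(x·ω) − ω·v`,
`x·((ω·∇)v) = ω·∇(x·v) − ω·v`, `x·Δω = Δ(x·ω) − 2 div ω = Δ(x·ω)`.) It is the NS counterpart of
the toroidal-velocity antidynamo computation for `r·B`. -/
def RadialVorticityLaw : Prop :=
  ∀ (S : Set ℝ) (ν : ℝ) (v : ℝ → ℝ³ → ℝ³) (q : ℝ → ℝ³ → ℝ),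
    IsOpen S → IsClassicalNSSolutionOn S ν 0 v q →
    ∀ t ∈ S, ∀ x,
      timeDerivWithin S (radialVorticity v) t x
          + fderiv ℝ (radialVorticity v t) x (v t x)
          - ν * (Δ (radialVorticity v t)) x
        = fderiv ℝ (fun y => ⟪y, v t y⟫_ℝ) x (curl (v t) x)

/-- **(2b) Kernel-metric monotonicity of the radial enstrophy for sphere-tangential flows.** If
`x·v ≡ 0` then `J(t) = ∫ (x·ω)² K` is non-increasing on `(−∞,0)`:
`J' = −2ν ∫ |∇(x·ω)|² K ≤ 0` (pair (2a) with the adapted kernel; transport drops out). -/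
def RadialEnstrophyMonotone : Prop :=
  ∀ (ν C C' : ℝ) (v : ℝ → ℝ³ → ℝ³) (q : ℝ → ℝ³ → ℝ) (K : ℝ → ℝ³ → ℝ),
    0 < ν → IsClassicalNSSolutionOn (Iio 0) ν 0 v q → HasTypeITimeDecay C v →
    (∀ t < (0:ℝ), ∀ x, ‖curl (v t) x‖ + (-t) * ‖fderiv ℝ (curl (v t)) x‖ ≤ C' / (-t)) →
    (∀ t < (0:ℝ), ∀ x, ⟪x, v t x⟫_ℝ = 0) →
    IsAdaptedBackwardKernel ν v (Iio 0) 0 0 K → IsGaussianComparable K (Iio 0) 0 0 →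
    AntitoneOn (fun t => ∫ x, radialVorticity v t x ^ 2 * K t x) (Iio 0)

/-- **(2c) Sphere-tangential exclusion** — `FrequencyRigidity` on the class `x·v ≡ 0`, with NO
frequency hypothesis: by (2b) and `J(t) ≤ C'² ∫|x|²K ≲ 1/(−t) → 0` as `t → −∞`, `J ≡ 0`, so
`x·ω ≡ 0`; a sphere-tangential solenoidal field with sphere-tangential curl vanishes
(`v = ∇T × x`, `x·curl v = −Δ_{S²}T = 0 ⇒ T = T(|x|) ⇒ v = 0`), contradicting `H > 0`. -/
def SphereTangentialExclusion : Prop :=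
  ¬ ∃ (ν C : ℝ) (v : ℝ → ℝ³ → ℝ³) (q : ℝ → ℝ³ → ℝ) (K : ℝ → ℝ³ → ℝ),
    0 < ν ∧ IsClassicalNSSolutionOn (Iio 0) ν 0 v q ∧ HasTypeITimeDecay C v ∧
    (∀ t < (0:ℝ), ∀ x, ⟪x, v t x⟫_ℝ = 0) ∧
    IsAdaptedBackwardKernel ν v (Iio 0) 0 0 K ∧ IsGaussianComparable K (Iio 0) 0 0 ∧
    (∀ t < (0:ℝ), 0 < adaptedEnstrophy v K t)

/-! ## Card `vorticity-cokernel-duality` -/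

/-- **Vorticity co-kernel**: a `C²` vector field `Θ` on `S × ℝ³` solving the ADJOINT of the full
vorticity operator `∂ₜ + v·∇ − (∇v) − νΔ` (stretching included):
`∂ₜΘ + (v·∇)Θ + (∇v)ᵀΘ + νΔΘ = 0`, where `((∇v)ᵀΘ)(x) = ∇_y ⟪Θ(x), v(y)⟫|_{y=x}`. -/
def IsVorticityCokernel (ν : ℝ) (v : ℝ → ℝ³ → ℝ³) (S : Set ℝ) (Θ : ℝ → ℝ³ → ℝ³) : Prop :=
  ContDiffOn ℝ 2 (uncurry Θ) (S ×ˢ univ) ∧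
    ∀ t ∈ S, ∀ x,
      timeDerivWithin S Θ t x + fderiv ℝ (Θ t) x (v t x)
          + gradient (fun y => ⟪Θ t x, v t y⟫_ℝ) x + ν • (Δ (Θ t)) x = 0

/-- **(3a) Exact duality (no defect).** Along a classical NS flow, the pairing of the vorticity with
any Gaussian-decaying co-kernel is CONSTANT in time:
`d/dt ∫ ⟪curl v, Θ⟫ = ∫ ⟪curl v, ∂ₜΘ + v·∇Θ + (∇v)ᵀΘ + νΔΘ⟫ = 0`
(vorticity equation + three integrations by parts, `div v = 0`). -/
def CokernelPairingConserved : Prop :=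
  ∀ (S : Set ℝ) (ν : ℝ) (v : ℝ → ℝ³ → ℝ³) (q : ℝ → ℝ³ → ℝ) (Θ : ℝ → ℝ³ → ℝ³),
    IsOpen S → IsClassicalNSSolutionOn S ν 0 v q → IsVorticityCokernel ν v S Θ →
    (∃ M : ℝ, ∀ t ∈ S, ∀ x, ‖v t x‖ + ‖fderiv ℝ (v t) x‖ + ‖fderiv ℝ (curl (v t)) x‖
        + ‖timeDerivWithin S (fun s y => curl (v s) y) t x‖ ≤ M) →
    (∃ c κ : ℝ, 0 < κ ∧ ∀ t ∈ S, ∀ x, ‖Θ t x‖ + ‖fderiv ℝ (Θ t) x‖ + ‖(Δ (Θ t)) x‖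
        + ‖timeDerivWithin S Θ t x‖ ≤ c * Real.exp (-κ * ‖x‖ ^ 2)) →
    ∀ t ∈ S, HasDerivWithinAt (fun s => ∫ x, ⟪curl (v s) x, Θ s x⟫_ℝ) 0 S t

/-- **(3b) Co-kernel Liouville criterion.** If a co-kernel from a point `(t₁, x₁)` in direction `e`
(pairing `→ ⟪e, ω(t₁,x₁)⟫` as `t ↑ t₁`) grows SUBLINEARLY in `L¹` backward in time, then under the
Type-I vorticity bound `|ω| ≤ C'/(−t)` the conserved pairing vanishes: `⟪e, ω(t₁,x₁)⟫ = 0`.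
Sublinear growth for all `(t₁,x₁,e)` ⇒ `ω ≡ 0` ⇒ `H ≡ 0`, refuting the `∃`-body of the crux. -/
def CokernelLiouvilleCriterion : Prop :=
  ∀ (ν C' t₁ : ℝ) (v : ℝ → ℝ³ → ℝ³) (Θ : ℝ → ℝ³ → ℝ³) (x₁ e : ℝ³),
    t₁ < 0 →
    (∀ t < (0:ℝ), ∀ x, ‖curl (v t) x‖ ≤ C' / (-t)) →
    IsVorticityCokernel ν v (Iio t₁) Θ →
    (∀ t < t₁, Integrable (Θ t)) →
    (∀ t < t₁, Integrable (fun x => ⟪curl (v t) x, Θ t x⟫_ℝ)) →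
    (∃ P₀ : ℝ, ∀ t < t₁, ∫ x, ⟪curl (v t) x, Θ t x⟫_ℝ = P₀) →
    Tendsto (fun t => ∫ x, ⟪curl (v t) x, Θ t x⟫_ℝ) (𝓝[<] t₁) (𝓝 ⟪e, curl (v t₁) x₁⟫_ℝ) →
    Tendsto (fun t => (∫ x, ‖Θ t x‖) / (-t)) atBot (𝓝 0) →
    ⟪e, curl (v t₁) x₁⟫_ℝ = 0

/-- **(3c) Trivial strain-threshold instance** (the co-kernel grows at most like
`exp ∫ λ_max(S)`): if `(−t)·λ_max(S(t,x)) ≤ θ < 1` everywhere then every co-kernel grows like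
`(t/t₁)^θ = o(|t|)`, so by (3a)–(3b) no such eternal Type-I flow has `H > 0`. Stated as the target
shape a prover would discharge first. -/
def SubcriticalStrainExclusion : Prop :=
  ∀ (θ : ℝ), θ < 1 →
  ¬ ∃ (ν C : ℝ) (v : ℝ → ℝ³ → ℝ³) (q : ℝ → ℝ³ → ℝ) (K : ℝ → ℝ³ → ℝ),
    0 < ν ∧ IsClassicalNSSolutionOn (Iio 0) ν 0 v q ∧ HasTypeITimeDecay C v ∧
    (∀ t < (0:ℝ), ∀ x h, ⟪fderiv ℝ (v t) x h, h⟫_ℝ ≤ θ / (-t) * ‖h‖ ^ 2) ∧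
    IsAdaptedBackwardKernel ν v (Iio 0) 0 0 K ∧ IsGaussianComparable K (Iio 0) 0 0 ∧
    (∀ t < (0:ℝ), 0 < adaptedEnstrophy v K t)

/-! ## Sanity links (pure logic) -/

/-- (2c) implies the crux on its class: any witness of the `∃`-body of `FrequencyRigidity` with
`x·v ≡ 0` would contradict `SphereTangentialExclusion` (the frequency clause is simply dropped). -/
theorem sphereTangential_sub_crux (h : SphereTangentialExclusion) :
    ¬ ∃ (ν C Λ₀ : ℝ) (v : ℝ → ℝ³ → ℝ³) (q : ℝ → ℝ³ → ℝ) (K : ℝ → ℝ³ → ℝ),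
      0 < ν ∧ IsClassicalNSSolutionOn (Iio 0) ν 0 v q ∧ HasTypeITimeDecay C v ∧
      (∀ t < (0:ℝ), ∀ x, ⟪x, v t x⟫_ℝ = 0) ∧
      IsAdaptedBackwardKernel ν v (Iio 0) 0 0 K ∧ IsGaussianComparable K (Iio 0) 0 0 ∧
      (∀ t < (0:ℝ), 0 < adaptedEnstrophy v K t) ∧ (∀ t < (0:ℝ), adaptedFrequency v K 0 t = Λ₀) := by
  rintro ⟨ν, C, Λ₀, v, q, K, hν, hcl, hTI, htan, hK, hG, hH, -⟩
  exact h ⟨ν, C, v, q, K, hν, hcl, hTI, htan, hK, hG, hH⟩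

end Summit.NavierStokesRegularity.NavierStokesRegularity.Cruxes.FrequencyRigidity.Ideator3
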